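import Summits.AtomisticToContinuum.FouriersLaw.Theses.OddSectorIrreversibility
import Summits.AtomisticToContinuum.FouriersLaw.Theses.TransferKernelPositivity
import Summits.AtomisticToContinuum.FouriersLaw.Theses.LocalOhmBV
import Summits.AtomisticToContinuum.FouriersLaw.Theorems.MatthiessenLadderLimitGlue
import Summits.AtomisticToContinuum.FouriersLaw.Theorems.MatthiessenLadderPrefixSteadyStates

/-!
# `BoundedResponseConverges` (crux stmt-AtomisticToContinuum-9141) from Matthiessen's rule ALONE

Helper file (`--supports stmt-AtomisticToContinuum-9141`, line `escape-deficit-dichotomy`, lead c23, route affinity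
`LocalOhmBV`). Route `MatthiessenLadder` closes the import slot `BoundedResponseConverges` (shared verbatim by
OddSectorIrreversibility / TransferKernelPositivity / LocalOhmBV / MatthiessenLadder) by its own engine
`PrefixIncrementLimit` (stmt-AtomisticToContinuum-12779, Matthiessen's rule proper for the prefix ladder
`cellChain ω₂ lam β γ (· < k)`) over the frame `PrefixSteadyStates` (stmt-AtomisticToContinuum-12778), glued by the landed
telescoping/Cesàro theorem `MatthiessenLadder.limitGlue_proof` (stmt-AtomisticToContinuum-12781). The frame was PROVED on
2026-08-17 (`MatthiessenLadderPrefixSteadyStates.PrefixSteadyStates_of`: CEHR Thm 5.1 for the mixed rungs), so the supplier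
pair 12779 ∧ 12778 recorded in the crux's registered skeleton collapses to the single open antecedent 12779: this file states
that one-hypothesis bridge for the slot and for each of its three route twins (syntactically identical `def`s, closed by
definitional unfolding). No new mathematics: composition of two landed theorems. Standard axioms.

References: Bonetto–Lebowitz–Rey-Bellet (2000) §5.3 eq. (33); Cuneo–Eckmann–Hairer–Rey-Bellet, EJP 23 (2018) Thm 5.1.
-/

namespace Summit.AtomisticToContinuum.FouriersLaw.Theorems.BoundedResponseConvergesOfPrefixIncrementLimit

open Summit.AtomisticToContinuum.FouriersLaw.Theses

/-- **Matthiessen's rule alone gives the slot.** `MatthiessenLadder.PrefixIncrementLimit` (stmt-12779) implies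
`MatthiessenLadder.BoundedResponseConverges` (stmt-9141 on that route): the landed `limitGlue_proof` fed with the proved frame
`PrefixSteadyStates_of`. [folklore] -/
theorem matthiessenLadder_boundedResponseConverges_of_prefixIncrementLimit : Summit.AtomisticToContinuum.FouriersLaw.Theses.MatthiessenLadder.PrefixIncrementLimit → Summit.AtomisticToContinuum.FouriersLaw.Theses.MatthiessenLadder.BoundedResponseConverges :=
  fun hL => MatthiessenLadder.limitGlue_proof hL MatthiessenLadderPrefixSteadyStates.PrefixSteadyStates_of

/-- The `OddSectorIrreversibility` twin of the slot from `PrefixIncrementLimit` alone (the twin `def` unfolds to the same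
statement). [folklore] -/
theorem oddSectorIrreversibility_boundedResponseConverges_of_prefixIncrementLimit
    (hL : MatthiessenLadder.PrefixIncrementLimit) : OddSectorIrreversibility.BoundedResponseConverges :=
  matthiessenLadder_boundedResponseConverges_of_prefixIncrementLimit hL

/-- The `TransferKernelPositivity` twin of the slot from `PrefixIncrementLimit` alone. [folklore] -/
theorem transferKernelPositivity_boundedResponseConverges_of_prefixIncrementLimit
    (hL : MatthiessenLadder.PrefixIncrementLimit) : TransferKernelPositivity.BoundedResponseConverges :=
  matthiessenLadder_boundedResponseConverges_of_prefixIncrementLimit hL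

/-- The `LocalOhmBV` twin of the slot from `PrefixIncrementLimit` alone. [folklore] -/
theorem localOhmBV_boundedResponseConverges_of_prefixIncrementLimit
    (hL : MatthiessenLadder.PrefixIncrementLimit) : LocalOhmBV.BoundedResponseConverges :=
  matthiessenLadder_boundedResponseConverges_of_prefixIncrementLimit hL

end Summit.AtomisticToContinuum.FouriersLaw.Theorems.BoundedResponseConvergesOfPrefixIncrementLimit
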